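import Summits.CriticalPhenomena.PercolationContinuityZ3.Theorems.PercNearOneGluingNoHeavyQuantBlobLawSizeBias
import HarnessLib

/-!
# QUANT lane R8, T-DEC: n EQUAL BLOBS WITH ARBITRARY GATES `gᵢ ∈ [1/2, 1)` ARE HEAVY AT THEIR AVERAGE GATE, FOR EVERY n —
# the general-gates reflection capacity of the Poisson-binomial law, by ratio monotonicity, size bias and Chebyshev
# (prim-quant-census-2 gen 82, file 2 of 2)

builds on p205010 (kernel theorem, internal audit signed; external expert review pending)

Support file (`--supports stmt-CriticalPhenomena-4575`), QUANT lane census seat prim-quant-census-2 (gen 82); memo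
`run/shared/lean/prim/quant/prim-quant-census-2-g82/REFLECTION-G82.md`.  Theorems only, standard axioms, no sorries, no definitions.

THE QUESTION (memo AFL-G81 §2 "not done", §5).  Conjecture BLOB-AFL (`…/prim-quant-census-2-g80/TRIPLE-G80.md` §5): the law of `n` blobs of a
common size `k` with gates `g₁..g_n` is HEAVY-DEC at the AVERAGE gate `(Σgᵢ)/n` with target its mean `k·Σgᵢ`.  Kernel before this file: every
gate vector up to width 4, every width when `Σg ≤ 2` (`heavy_blobLaw_of_mean_le_two`), and every width with EQUAL gates `g ≥ 1/2`
(`heavy_blobLaw_replicate_of_half_le`, via the reflection certificate `heavy_of_reflection` and the one-line capacity `(1−g)^{n−2j−1} ≤ g^{n−2j−1}`).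
The general-gates reflection capacity was known only numerically (AFL-G81 §3.4: 3 000 vectors per `n ≤ 15`, never violated, tight at all `½`).

THE THEOREM (uniform in `n` AND in the gate vector).  Write `P_G(j)` for the Poisson-binomial point mass of the gate list `G` (`n = |G|`,
`S = ΣG`), i.e. `blobLaw (G.map (k, ·)) (j·k)`; the toolkit (`pb_ratio_mono`, `pb_choose_mono`, `pb_size_bias_succ/fail`, `exists_common_remainder`,
`blobLaw_perm`) is `…QuantBlobLawSizeBias` (file 1 of 2).
* `pb_loo_pair_nonneg` — for gates in `[1/2,1]` and `2j + 1 ≤ n` the leave-one-out masses are ordered like the gates: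
  `(g_m − g_l)·(P_{G∖m}(j) − P_{G∖l}(j)) = (g_m − g_l)²·(P_W(j) − P_W(j−1)) ≥ 0`, `W` the common remainder (`exists_common_remainder`,
  `blobLaw_perm`, `slice_comm`) and `P_W(j) ≥ P_W(j−1)` by ratio monotonicity (`|W| = n − 2 ≥ 2j − 1`).
* `pb_key_ineq` — Chebyshev's sum inequality (`chebyshev_sum_ineq`) on these: **`S·(n − j)·P_G(j) ≤ (n − S)·(j + 1)·P_G(j+1)`** (`2j+1 ≤ n`).
* **`pb_reflection_capacity`** — with the ratio-monotone chain from `j + 1` to `n − j`: **`S·P_G(j) ≤ (n − S)·P_G(n − j)`** for gates in `[1/2, 1]`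
  and `2j + 1 ≤ n`; equivalently `e_{n−j}(o)·Σ(1−gᵢ) ≥ e_j(o)·Σgᵢ` for the odds `oᵢ ≥ 1`; EQUALITY for every `j` at all gates `= 1/2`, so the
  hypothesis `gᵢ ≥ 1/2` cannot be weakened termwise (it is false for general gates, AFL-G81 §3.4).
* **`heavy_blobLaw_gates_of_half_le`** / list form **`heavy_blobLaw_of_half_le_gates`** — `n` EQUAL BLOBS WITH ARBITRARY GATES `gᵢ ∈ [1/2, 1)` ARE
  HEAVY AT FLOOR `(Σgᵢ)/n` AND TARGET `k·Σgᵢ`, EVERY `n`, EVERY `k` (`heavy_of_reflection`; a low atom `j·k`, `2j < S ≤ n`, has `2j+1 ≤ n`).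
  `decAtT_blobLaw_gates_of_half_le` / `decAtT_blobLaw_of_half_le_gates`: DEC at every layer.  Supersedes `heavy_blobLaw_replicate_of_half_le`.
NET.  Conjecture BLOB-AFL is now kernel for EVERY width on both flanks `Σg ≤ 2` and `min g ≥ 1/2` with arbitrary gates; what remains is the middle
band (`min g < 1/2`, `Σg > 2`) beyond width 4 (memo AFL-G81 §3.5).

HONEST STATUS.  Tool; `SiblingStep`, `FarTreeRow`, `GluedLemmaW`, `GluedDominatedMass` OPEN; RATE class (log\*) / honest sentence of
`run/shared/lean/prim/quant/README.md` unchanged.  [this work]; Chebyshev's sum inequality and the size-bias identity are classical [folklore].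
Nothing here is cited as a published result.  The gluing rows served [cite: KozmaNitzan2024, Conjecture 3 (p. 15)]; product measure
[cite: Grimmett1999, §1.3 p. 10].
-/


noncomputable section

open scoped BigOperators

namespace Summit.CriticalPhenomena.PercolationContinuityZ3.Theorems
namespace Quant

open Finset

/-- the two-point law `{lo, hi; g}` (as in `…QuantLawDEC`) -/
local notation3 "TP[" lo ", " hi ", " g ", " h "]" =>
  (g : ℝ) * (if (h : ℕ) = (hi : ℕ) then (1 : ℝ) else 0) + (1 - (g : ℝ)) * (if (h : ℕ) = (lo : ℕ) then (1 : ℝ) else 0)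

/-- the Poisson-binomial point mass `P_G(j)`: the law of the blobs `(k, g)`, `g ∈ G`, at the atom `j·k` -/
local notation3 "PB[" k ", " G ", " j "]" => LawDec.blobLaw (List.map (fun g : ℝ => ((k : ℕ), g)) G) ((j : ℕ) * (k : ℕ))

namespace LawDec

/-! ### Chebyshev's sum inequality on the leave-one-out masses -/

/-- **LEAVE-ONE-OUT MONOTONICITY.** For gates in `[1/2, 1]` and `2j + 1 ≤ n`, the leave-one-out masses `P_{G∖m}(j)` are ordered like
the gates: `(g_m − g_l)·(P_{G∖m}(j) − P_{G∖l}(j)) ≥ 0` (both lists are `g_l`, resp. `g_m`, consed onto a common `W`, and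
`P_W(j) ≥ P_W(j−1)` by ratio monotonicity since `|W| = n − 2 ≥ 2j − 1`). [this work] -/
theorem pb_loo_pair_nonneg (k : ℕ) (hk : 0 < k) (G : List ℝ) (hG : ∀ g ∈ G, 1 / 2 ≤ g ∧ g ≤ 1) (j : ℕ)
    (hj : 2 * j + 1 ≤ G.length) (m l : Fin G.length) :
    0 ≤ (G.get m - G.get l) * (PB[k, G.eraseIdx m, j] - PB[k, G.eraseIdx l, j]) := by
  by_cases hml : m = l
  · subst hml; simp
  obtain ⟨W, h1, h2, h3, h4⟩ := exists_common_remainder G m l hml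
  have hW : ∀ g ∈ W, 1 / 2 ≤ g ∧ g ≤ 1 := fun g hg => hG g (h3 g hg)
  have hW0 : ∀ g ∈ W, 0 ≤ g ∧ g ≤ 1 := fun g hg => ⟨by linarith [(hW g hg).1], (hW g hg).2⟩
  rw [blobLaw_perm (h1.map _), blobLaw_perm (h2.map _), List.map_cons, List.map_cons]
  cases j with
  | zero =>
    have e1 := pb_cons_zero k hk (G.get l) W
    have e2 := pb_cons_zero k hk (G.get m) W
    rw [List.map_cons] at e1 e2
    rw [e1, e2]
    have h0 := pb_nonneg k W hW0 0
    have : (G.get m - G.get l) * ((1 - G.get l) * PB[k, W, 0] - (1 - G.get m) * PB[k, W, 0])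
        = (G.get m - G.get l) ^ 2 * PB[k, W, 0] := by ring
    rw [this]
    positivity
  | succ j =>
    have e1 := pb_cons_succ k (G.get l) W j
    have e2 := pb_cons_succ k (G.get m) W j
    rw [List.map_cons] at e1 e2
    rw [e1, e2]
    have hr := pb_ratio_mono k hk W hW j
    have hPj := pb_nonneg k W hW0 j
    have hWl : (2 : ℝ) * j + 1 ≤ (W.length : ℝ) := by exact_mod_cast (by omega : 2 * j + 1 ≤ W.length)
    have h5 : ((j : ℝ) + 1) * PB[k, W, j] ≤ ((j : ℝ) + 1) * PB[k, W, j + 1] := by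
      nlinarith [mul_nonneg (by linarith : (0 : ℝ) ≤ (W.length : ℝ) - j - (j + 1)) hPj]
    have hmono : PB[k, W, j] ≤ PB[k, W, j + 1] := le_of_mul_le_mul_left h5 (by positivity)
    have : (G.get m - G.get l) * ((1 - G.get l) * PB[k, W, j + 1] + G.get l * PB[k, W, j]
        - ((1 - G.get m) * PB[k, W, j + 1] + G.get m * PB[k, W, j]))
        = (G.get m - G.get l) ^ 2 * (PB[k, W, j + 1] - PB[k, W, j]) := by ring
    rw [this]
    exact mul_nonneg (sq_nonneg _) (sub_nonneg.2 hmono)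

/-- Chebyshev's sum inequality, finite form: if `(g m − g l)(A m − A l) ≥ 0` for all `m, l`, then `Σg · ΣA ≤ n · Σ g·A`. [folklore] -/
theorem chebyshev_sum_ineq (n : ℕ) (g A : Fin n → ℝ) (h : ∀ m l, 0 ≤ (g m - g l) * (A m - A l)) :
    (∑ m, g m) * (∑ m, A m) ≤ (n : ℝ) * ∑ m, g m * A m := by
  have h0 : 0 ≤ ∑ m, ∑ l, (g m - g l) * (A m - A l) :=
    Finset.sum_nonneg fun m _ => Finset.sum_nonneg fun l _ => h m l
  have e : ∀ m l : Fin n, (g m - g l) * (A m - A l) = (g m * A m + g l * A l) - (g m * A l + g l * A m) :=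
    fun _ _ => by ring
  simp only [e, Finset.sum_sub_distrib, Finset.sum_add_distrib] at h0
  have t1 : ∑ m : Fin n, ∑ _l : Fin n, g m * A m = (n : ℝ) * ∑ m, g m * A m := by
    simp only [Finset.sum_const, Finset.card_univ, Fintype.card_fin, nsmul_eq_mul]
    rw [Finset.mul_sum]
  have t2 : ∑ _m : Fin n, ∑ l : Fin n, g l * A l = (n : ℝ) * ∑ m, g m * A m := by
    rw [Finset.sum_const, Finset.card_univ, Fintype.card_fin, nsmul_eq_mul]
  have t3 : ∑ m : Fin n, ∑ l : Fin n, g m * A l = (∑ m, g m) * ∑ m, A m := by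
    rw [Finset.sum_mul]
    exact Finset.sum_congr rfl fun m _ => by rw [Finset.mul_sum]
  have t4 : ∑ m : Fin n, ∑ l : Fin n, g l * A m = (∑ m, g m) * ∑ m, A m := by
    rw [Finset.sum_comm, Finset.sum_mul]
    exact Finset.sum_congr rfl fun l _ => by rw [Finset.mul_sum]
  rw [t1, t2, t3, t4] at h0
  linarith

/-- the gates sum to `Σ_m g_m` over the indices. [folklore] -/
theorem sum_get_eq_sum (G : List ℝ) : ∑ m : Fin G.length, G.get m = G.sum := by
  rw [← Fin.sum_ofFn, List.ofFn_get]

/-- gates `≤ 1` sum to at most `n`. [folklore] -/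
theorem sum_le_length : ∀ G : List ℝ, (∀ g ∈ G, g ≤ 1) → G.sum ≤ G.length
  | [], _ => by simp
  | a :: G, h => by
    rw [List.sum_cons, List.length_cons]
    push_cast
    have := sum_le_length G fun g hg => h g (List.mem_cons_of_mem a hg)
    linarith [h a List.mem_cons_self]

/-- gates `≥ 1/2` sum to at least `n/2`. [folklore] -/
theorem half_length_le_sum : ∀ G : List ℝ, (∀ g ∈ G, 1 / 2 ≤ g) → (G.length : ℝ) / 2 ≤ G.sum
  | [], _ => by simp
  | a :: G, h => by
    rw [List.sum_cons, List.length_cons]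
    push_cast
    have := half_length_le_sum G fun g hg => h g (List.mem_cons_of_mem a hg)
    linarith [h a List.mem_cons_self]

/-- **THE KEY INEQUALITY** (Chebyshev's sum inequality applied to the size-bias identities): for gates in `[1/2,1]`, `S = ΣG`,
`n = |G|` and `2j + 1 ≤ n`: `S·(n − j)·P_G(j) ≤ (n − S)·(j + 1)·P_G(j+1)`. [this work] -/
theorem pb_key_ineq (k : ℕ) (hk : 0 < k) (G : List ℝ) (hG : ∀ g ∈ G, 1 / 2 ≤ g ∧ g ≤ 1) (j : ℕ)
    (hj : 2 * j + 1 ≤ G.length) :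
    G.sum * (((G.length : ℝ) - j) * PB[k, G, j]) ≤ ((G.length : ℝ) - G.sum) * (((j : ℝ) + 1) * PB[k, G, j + 1]) := by
  have hc : (∑ m : Fin G.length, G.get m) * (∑ m : Fin G.length, PB[k, G.eraseIdx m, j])
      ≤ (G.length : ℝ) * ∑ m : Fin G.length, G.get m * PB[k, G.eraseIdx m, j] :=
    chebyshev_sum_ineq G.length (fun m => G.get m) (fun m => PB[k, G.eraseIdx m, j])
      (fun m l => pb_loo_pair_nonneg k hk G hG j hj m l)
  have hA := pb_size_bias_succ k hk G j
  have hB := pb_size_bias_fail k hk G j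
  have hsumA : ∑ m : Fin G.length, PB[k, G.eraseIdx m, j]
      = ((j : ℝ) + 1) * PB[k, G, j + 1] + ((G.length : ℝ) - j) * PB[k, G, j] := by
    rw [← hA, ← hB, ← Finset.sum_add_distrib]
    exact Finset.sum_congr rfl fun m _ => by ring
  rw [sum_get_eq_sum, hA, hsumA] at hc
  nlinarith [hc]

/-- **THE GENERAL-GATES REFLECTION CAPACITY of the Poisson-binomial law.** For gates `gᵢ ∈ [1/2, 1]`, `S = Σgᵢ`, `n = |G|` and
`2j + 1 ≤ n`: `S·P_G(j) ≤ (n − S)·P_G(n − j)` — i.e. `e_{n−j}(o)·Σ(1−gᵢ) ≥ e_j(o)·Σgᵢ` for the odds `oᵢ = gᵢ/(1−gᵢ) ≥ 1`; equality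
for every `j` at all gates `= 1/2` (memo AFL-G81 §3.4).  Key inequality + the ratio-monotone chain from `j+1` to `n−j`. [this work] -/
theorem pb_reflection_capacity (k : ℕ) (hk : 0 < k) (G : List ℝ) (hG : ∀ g ∈ G, 1 / 2 ≤ g ∧ g ≤ 1) (j : ℕ)
    (hj : 2 * j + 1 ≤ G.length) :
    G.sum * PB[k, G, j] ≤ ((G.length : ℝ) - G.sum) * PB[k, G, G.length - j] := by
  have hG0 : ∀ g ∈ G, 0 ≤ g ∧ g ≤ 1 := fun g hg => ⟨by linarith [(hG g hg).1], (hG g hg).2⟩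
  have hkey := pb_key_ineq k hk G hG j hj
  have hmono := pb_choose_mono k hk G hG (j + 1) (G.length - j - (j + 1))
  rw [show j + 1 + (G.length - j - (j + 1)) = G.length - j by omega, Nat.choose_symm (by omega : j ≤ G.length)] at hmono
  have hc : (G.length.choose (j + 1) : ℝ) * ((j : ℝ) + 1) = (G.length.choose j : ℝ) * ((G.length : ℝ) - j) := by
    have h := Nat.choose_succ_right_eq G.length j
    rw [← Nat.cast_sub (by omega : j ≤ G.length)]
    exact_mod_cast h
  have hCpos : (0 : ℝ) < G.length.choose j := by exact_mod_cast Nat.choose_pos (by omega)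
  have hchain : ((j : ℝ) + 1) * PB[k, G, j + 1] ≤ ((G.length : ℝ) - j) * PB[k, G, G.length - j] := by
    have h1 : (G.length.choose j : ℝ) * (((j : ℝ) + 1) * PB[k, G, j + 1])
        ≤ (G.length.choose j : ℝ) * (((G.length : ℝ) - j) * PB[k, G, G.length - j]) := by
      calc (G.length.choose j : ℝ) * (((j : ℝ) + 1) * PB[k, G, j + 1])
          = ((j : ℝ) + 1) * ((G.length.choose j : ℝ) * PB[k, G, j + 1]) := by ring
        _ ≤ ((j : ℝ) + 1) * ((G.length.choose (j + 1) : ℝ) * PB[k, G, G.length - j]) :=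
            mul_le_mul_of_nonneg_left hmono (by positivity)
        _ = (G.length.choose (j + 1) : ℝ) * ((j : ℝ) + 1) * PB[k, G, G.length - j] := by ring
        _ = (G.length.choose j : ℝ) * (((G.length : ℝ) - j) * PB[k, G, G.length - j]) := by rw [hc]; ring
    exact le_of_mul_le_mul_left h1 hCpos
  have hS0 : 0 ≤ (G.length : ℝ) - G.sum := sub_nonneg.2 (sum_le_length G fun g hg => (hG g hg).2)
  have hnj : (0 : ℝ) < (G.length : ℝ) - j := by
    have : (j : ℝ) < G.length := by exact_mod_cast (by omega : j < G.length)
    linarith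
  have h2 : G.sum * (((G.length : ℝ) - j) * PB[k, G, j])
      ≤ ((G.length : ℝ) - G.sum) * (((G.length : ℝ) - j) * PB[k, G, G.length - j]) :=
    hkey.trans (mul_le_mul_of_nonneg_left hchain hS0)
  have h3 : ((G.length : ℝ) - j) * (G.sum * PB[k, G, j])
      ≤ ((G.length : ℝ) - j) * (((G.length : ℝ) - G.sum) * PB[k, G, G.length - j]) := by
    calc ((G.length : ℝ) - j) * (G.sum * PB[k, G, j]) = G.sum * (((G.length : ℝ) - j) * PB[k, G, j]) := by ring
      _ ≤ ((G.length : ℝ) - G.sum) * (((G.length : ℝ) - j) * PB[k, G, G.length - j]) := h2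
      _ = ((G.length : ℝ) - j) * (((G.length : ℝ) - G.sum) * PB[k, G, G.length - j]) := by ring
  exact le_of_mul_le_mul_left h3 hnj

/-! ### n equal blobs with arbitrary gates `gᵢ ∈ [1/2, 1)` are heavy at their average gate, every `n` -/

/-- **n EQUAL BLOBS WITH ARBITRARY GATES `gᵢ ∈ [1/2, 1)` ARE HEAVY AT FLOOR `(Σgᵢ)/n` (THE AVERAGE GATE), TARGET THEIR MEAN `k·Σgᵢ` —
EVERY `n`, EVERY `k`** (conjecture BLOB-AFL of `TRIPLE-G80.md` §5 on the flank `min gᵢ ≥ 1/2`, uniformly in the width and the gate vector):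
the reflection certificate `b ↔ n·k − b` at the floor gate (`heavy_of_reflection`) with the general-gates capacity `pb_reflection_capacity`.
Supersedes `heavy_blobLaw_replicate_of_half_le` (equal gates). [this work] -/
theorem heavy_blobLaw_gates_of_half_le (k : ℕ) (G : List ℝ) (hG : ∀ g ∈ G, 1 / 2 ≤ g ∧ g < 1) :
    ∃ (ι : Type) (_ : Fintype ι) (lam γ : ι → ℝ) (lo hi : ι → ℕ),
      (∀ i, 0 ≤ lam i) ∧ (∑ i, lam i = 1) ∧ (∀ i, 0 ≤ γ i ∧ γ i ≤ 1) ∧ (∀ i, lo i ≤ hi i) ∧ (∀ i, hi i ≤ G.length * k) ∧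
      (∀ h, blobLaw (List.map (fun g : ℝ => (k, g)) G) h = ∑ i, lam i * TP[lo i, hi i, γ i, h]) ∧
      (∀ i, 0 < lam i → G.sum / G.length ≤ γ i ∧ (k : ℝ) * G.sum ≤ 2 * (lo i : ℝ) + ((hi i : ℝ) - lo i) * γ i) := by
  have hG1 : ∀ g ∈ G, 1 / 2 ≤ g ∧ g ≤ 1 := fun g hg => ⟨(hG g hg).1, (hG g hg).2.le⟩
  have hG0 : ∀ g ∈ G, 0 ≤ g ∧ g ≤ 1 := fun g hg => ⟨by linarith [(hG g hg).1], (hG g hg).2.le⟩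
  have htop := blobTop_blobs k G
  have hμ0 := blobLaw_nonneg _ (blobs_gates_mem k G hG0)
  have hμM : ∀ h, G.length * k < h → blobLaw (List.map (fun g : ℝ => (k, g)) G) h = 0 :=
    fun h hh => blobLaw_eq_zero _ h (by rw [htop]; exact hh)
  have hμ1 : ∑ h ∈ Finset.range (G.length * k + 1), blobLaw (List.map (fun g : ℝ => (k, g)) G) h = 1 := by
    have h1 := sum_blobLaw (List.map (fun g : ℝ => (k, g)) G); rwa [htop] at h1
  have hSn : G.sum ≤ G.length := sum_le_length G fun g hg => (hG g hg).2.le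
  rcases Nat.eq_zero_or_pos G.length with hn0 | hnpos
  · -- no blobs: the point mass at `0`, floor `0`, target `0`
    have hGnil : G = [] := List.eq_nil_of_length_eq_zero hn0
    subst hGnil
    simp only [List.sum_nil, List.length_nil, Nat.cast_zero, div_zero, mul_zero]
    refine heavy_of_reflection (0 * k) _ 0 0 le_rfl zero_lt_one hμ0 hμM hμ1 (by simp) ?_
    intro b hb
    have : (0 : ℝ) ≤ 2 * (b : ℝ) := by positivity
    linarith
  have hn : (0 : ℝ) < G.length := by exact_mod_cast hnpos
  -- some gate is `< 1`, so `S < n`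
  have hSlt : G.sum < G.length := by
    obtain ⟨a, G', rfl⟩ := List.exists_cons_of_length_pos hnpos
    rw [List.sum_cons, List.length_cons]
    push_cast
    have := sum_le_length G' fun g hg => (hG g (List.mem_cons_of_mem a hg)).2.le
    linarith [(hG a List.mem_cons_self).2]
  have hx0 : 0 ≤ G.sum / G.length := div_nonneg (by linarith [half_length_le_sum G fun g hg => (hG g hg).1]) hn.le
  have hx1 : G.sum / G.length < 1 := (div_lt_one hn).2 hSlt
  refine heavy_of_reflection (G.length * k) _ (G.sum / G.length) ((k : ℝ) * G.sum) hx0 hx1 hμ0 hμM hμ1 ?_ ?_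
  · push_cast
    have e : G.sum / (G.length : ℝ) * ((G.length : ℝ) * k) = (k : ℝ) * G.sum := by
      field_simp
    rw [e]
  · intro b hb
    by_cases hdvd : k ∣ b
    · obtain ⟨j, rfl⟩ := hdvd
      rcases Nat.eq_zero_or_pos k with hk0 | hk
      · subst hk0
        simp only [Nat.cast_zero, zero_mul] at hb
        have : (0 : ℝ) ≤ 2 * ((0 * j : ℕ) : ℝ) := by positivity
        linarith
      have hk' : (0 : ℝ) < k := by exact_mod_cast hk
      -- `2j < S ≤ n`, so `2j + 1 ≤ n`
      have h2j : 2 * (j : ℝ) < G.sum := by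
        have e : 2 * ((k * j : ℕ) : ℝ) = (2 * (j : ℝ)) * k := by push_cast; ring
        rw [e] at hb
        have hb' : (2 * (j : ℝ)) * k < G.sum * k := by linarith
        exact lt_of_mul_lt_mul_right hb' hk'.le
      have hjn : 2 * j + 1 ≤ G.length := by
        have : (2 * j : ℝ) < G.length := by linarith
        exact_mod_cast this
      have hcap := pb_reflection_capacity k hk G hG1 j hjn
      rw [show k * j = j * k by ring, show G.length * k - j * k = (G.length - j) * k by rw [Nat.sub_mul]]
      refine le_of_mul_le_mul_left ?_ hn
      calc (G.length : ℝ) * (G.sum / G.length * PB[k, G, j]) = G.sum * PB[k, G, j] := by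
            field_simp
        _ ≤ ((G.length : ℝ) - G.sum) * PB[k, G, G.length - j] := hcap
        _ = (G.length : ℝ) * ((1 - G.sum / G.length) * PB[k, G, G.length - j]) := by
            field_simp
    · rw [blobLaw_eq_zero_of_not_dvd k _ (fun p hp => by
          obtain ⟨g, _, rfl⟩ := List.mem_map.1 hp; exact dvd_rfl) b hdvd, mul_zero]
      exact mul_nonneg (by linarith) (hμ0 _)

/-- **hence DEC at every layer** for `n` equal blobs with arbitrary gates `gᵢ ∈ [1/2, 1)`. [this work] -/
theorem decAtT_blobLaw_gates_of_half_le (k : ℕ) (G : List ℝ) (hG : ∀ g ∈ G, 1 / 2 ≤ g ∧ g < 1) (j : ℕ) :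
    DECAtT (G.sum / G.length) ((k : ℝ) * G.sum) j (G.length * k) (blobLaw (List.map (fun g : ℝ => (k, g)) G)) :=
  decAtT_of_heavy _ _ _ _ (heavy_blobLaw_gates_of_half_le k G hG) j


/-! ### List form, in the vocabulary of `heavy_blobLaw_of_mean_le_two` -/

/-- a blob list with all sizes `= k` is its gate list `l.map Prod.snd` as blobs of size `k`. [this work] -/
theorem eq_map_blobs_of_sizes (k : ℕ) : ∀ l : List (ℕ × ℝ), (∀ p ∈ l, p.1 = k) →
    l = List.map (fun g : ℝ => (k, g)) (l.map Prod.snd)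
  | [], _ => rfl
  | p :: l, hl => by
    have hp : p.1 = k := hl p List.mem_cons_self
    rw [List.map_cons, List.map_cons, ← eq_map_blobs_of_sizes k l fun q hq => hl q (List.mem_cons_of_mem p hq)]
    obtain ⟨a, g⟩ := p
    simp only at hp
    subst hp
    rfl

/-- **LIST FORM** (the vocabulary of `heavy_blobLaw_of_mean_le_two`): a blob list with all sizes `= k` and all gates in `[1/2, 1)` is
heavy at floor `blobMean l / blobTop l` (its AVERAGE gate) and target `blobMean l`, whatever its length. [this work] -/
theorem heavy_blobLaw_of_half_le_gates (k : ℕ) (l : List (ℕ × ℝ)) (hl : ∀ p ∈ l, p.1 = k ∧ 1 / 2 ≤ p.2 ∧ p.2 < 1) :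
    ∃ (ι : Type) (_ : Fintype ι) (lam γ : ι → ℝ) (lo hi : ι → ℕ),
      (∀ i, 0 ≤ lam i) ∧ (∑ i, lam i = 1) ∧ (∀ i, 0 ≤ γ i ∧ γ i ≤ 1) ∧ (∀ i, lo i ≤ hi i) ∧ (∀ i, hi i ≤ blobTop l) ∧
      (∀ h, blobLaw l h = ∑ i, lam i * TP[lo i, hi i, γ i, h]) ∧
      (∀ i, 0 < lam i → blobMean l / blobTop l ≤ γ i ∧ blobMean l ≤ 2 * (lo i : ℝ) + ((hi i : ℝ) - lo i) * γ i) := by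
  obtain ⟨G, hG, rfl⟩ : ∃ G : List ℝ, (∀ g ∈ G, 1 / 2 ≤ g ∧ g < 1) ∧ l = List.map (fun g : ℝ => (k, g)) G := by
    refine ⟨l.map Prod.snd, fun g hg => ?_, eq_map_blobs_of_sizes k l fun p hp => (hl p hp).1⟩
    obtain ⟨p, hp, rfl⟩ := List.mem_map.1 hg
    exact ⟨(hl p hp).2.1, (hl p hp).2.2⟩
  rw [blobTop_blobs, blobMean_blobs]
  obtain ⟨ι, hι, lam, γ, lo, hi, h1, h2, h3, h4, h5, h6, h7⟩ := heavy_blobLaw_gates_of_half_le k G hG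
  refine ⟨ι, hι, lam, γ, lo, hi, h1, h2, h3, h4, h5, h6, fun i hi' => ⟨?_, (h7 i hi').2⟩⟩
  rcases Nat.eq_zero_or_pos k with hk0 | hk
  · subst hk0
    simp only [Nat.cast_zero, zero_mul, zero_div]
    exact (h3 i).1
  · rcases Nat.eq_zero_or_pos G.length with hn0 | hn
    · rw [hn0, Nat.zero_mul, Nat.cast_zero, div_zero]
      exact (h3 i).1
    · have hk' : (k : ℝ) ≠ 0 := by exact_mod_cast hk.ne'
      have hn' : (G.length : ℝ) ≠ 0 := by exact_mod_cast hn.ne'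
      have e : (k : ℝ) * G.sum / ((G.length * k : ℕ) : ℝ) = G.sum / G.length := by
        push_cast
        field_simp
      rw [e]
      exact (h7 i hi').1

/-- **hence DEC at every layer**, list form. [this work] -/
theorem decAtT_blobLaw_of_half_le_gates (k : ℕ) (l : List (ℕ × ℝ)) (hl : ∀ p ∈ l, p.1 = k ∧ 1 / 2 ≤ p.2 ∧ p.2 < 1) (j : ℕ) :
    DECAtT (blobMean l / blobTop l) (blobMean l) j (blobTop l) (blobLaw l) :=
  decAtT_of_heavy _ _ _ _ (heavy_blobLaw_of_half_le_gates k l hl) j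

end LawDec
end Quant
end Summit.CriticalPhenomena.PercolationContinuityZ3.Theorems
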